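import Mathlib
import HarnessLib
import Summits.Ventures.LatticeQCDFlow.Scoring.UStatisticStrongLaw

/-!
# Hoeffding's central limit theorem for an order-2 U-statistic with a square-integrable symmetric
# kernel along an i.i.d. stream: `√n (U_n(F) − μ_F) ⇒ N(0, 4ζ₁)`, `ζ₁ = Var_ν h`, `h` Hoeffding's
# projection — Mathlib's CLT for the projection plus the degenerate remainder `√n U_n(G) → 0` in
# probability

HONEST FRAMING: exact (Metropolis-corrected) sampling algorithms for lattice gauge theory;
figures of merit are autocorrelation/cost numbers at stated couplings and volumes; no
continuum-physics claim.

Venture `LatticeQCDFlow` (cell pub-lqcd), topic `Scoring`; FANOUT row 4 (`s0-u1-b`, rung S0-B).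
Sequel of `Scoring/UStatisticStrongLaw` (imported: Hoeffding's decomposition
`U_n(F) − μ_F = 2(H̄_n − μ_F) + U_n(G)` as a finite-sum identity, the degenerate remainder kernel
`G(a, b) = F(a, b) − h(a) − h(b) + μ_F`, `∫ G(a, b) dν(b) = 0` for every `a`).  Multiplying by `√n`:
`√n (U_n(F) − μ_F) = 2·(Σ_{i<n} (h(x_i) − μ_F))/√n + √n U_n(G)`.  The first term is Mathlib's
central limit theorem (`ProbabilityTheory.tendstoInDistribution_inv_sqrt_mul_sum_sub`) for the
i.i.d. projections `h(x_i)` (mean `μ_F`, variance `ζ₁ = ∫ h² dν − μ_F²`), doubled by the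
continuous mapping theorem; the second tends to `0` IN PROBABILITY because row 3's exact Hoeffding
variance gives `Var(√n U_n(G)) = 2n·ζ₂(G)/(n(n − 1)) = 2ζ₂(G)/(n − 1) → 0` (Chebyshev); Slutsky
(Mathlib's `TendstoInDistribution.add_of_tendstoInMeasure_const`) adds them, and
`tendstoInDistribution_of_tendstoInMeasure_sub` moves from the decomposed sequence to
`√n (U_n − μ_F)` (they agree for `n ≥ 2`).  Printed counterpart NAMED ONLY: Hoeffding, Ann. Math.
Statist. 19 (1948) 293–325, Thm 7.1; Serfling (1980) §5.5.1.  NEW WORK of the cell (our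
formalisation of a classical theorem); no definition is introduced; nothing is cited as a fact.
The application to the printed acceptance ratio is the next file.

## Content (`ν` a probability law on `X`; stream `x : ℕ → Ω → X` independent with laws `ν`;
## `U_n(F) = Σ_{i ≠ j < n} F(x_i, x_j)/(n(n − 1))`; `μ_F = ∫ F d(ν ⊗ ν)`; `h(a) = ∫ F(a, b) dν(b)`;
## `ζ₁ = ∫ h² dν − μ_F²`)

* `sqrt_mul_div_sub` (`√n·(H/n − m) = (√n)⁻¹·(H − n·m)`);
* **`degenerateUStat_sqrt_tendstoInMeasure_zero`** — `G` symmetric, measurable, `G ∈ L²(ν ⊗ ν)`,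
  degenerate ⇒ `√n U_n(G) → 0` in probability;
* `tendstoInDistribution_two_mul_projection` — `2(Σ_{i<n} h(x_i) − nμ_F)/√n ⇒ 2Y`,
  `Y ∼ N(0, ζ₁)`;
* **`ustat₂_clt`** — THE THEOREM: for any `Y` with law `N(0, ζ₁)` (on any probability space),
  `√n (U_n(F) − μ_F) ⇒ 2·Y` in distribution (so the limit law is `N(0, 4ζ₁)`:
  `hasLaw_two_mul_gaussian`).

NOT CLAIMED: a Berry–Esseen rate; degenerate kernels' non-Gaussian limits (`ζ₁ = 0` is included,
with the Dirac limit); higher orders; any number of ours re-scored.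
-/

noncomputable section

namespace Summit.Ventures.LatticeQCDFlow.Scoring.CardConsistency

open MeasureTheory ProbabilityTheory Finset Real Filter
open scoped Topology Function ENNReal

/-! ## §1 Algebra and the law of `2Y` -/

section Algebra

/-- `√n·(H/n − m) = (√n)⁻¹·(H − n·m)` for `n ≥ 1`. [ours] -/
theorem sqrt_mul_div_sub {n : ℕ} (hn : 1 ≤ n) (H m : ℝ) :
    Real.sqrt n * (H / n - m) = (Real.sqrt n)⁻¹ * (H - n * m) := by
  have hn0 : (0 : ℝ) < n := by exact_mod_cast hn
  have hsq : Real.sqrt n ≠ 0 := (Real.sqrt_pos.2 hn0).ne'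
  rw [eq_comm, inv_mul_eq_iff_eq_mul₀ hsq, ← mul_assoc, Real.mul_self_sqrt hn0.le, mul_sub,
    mul_div_cancel₀ _ hn0.ne']

/-- `2·Y ∼ N(0, 4v)` for `Y ∼ N(0, v)`. [folklore] -/
theorem hasLaw_two_mul_gaussian {Ω' : Type*} [MeasurableSpace Ω'] {P' : Measure Ω'} {Y : Ω' → ℝ}
    {v : NNReal} (hY : HasLaw Y (gaussianReal 0 v) P') :
    HasLaw (fun ω' => 2 * Y ω') (gaussianReal 0 (4 * v)) P' := by
  have h := gaussianReal_const_mul hY 2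
  have e : NNReal.mk ((2 : ℝ) ^ 2) (sq_nonneg _) = 4 := NNReal.eq (by norm_num)
  rw [mul_zero, e] at h
  exact h

end Algebra

/-! ## §2 The degenerate remainder at the `√n` scale vanishes in probability -/

section Degenerate

variable {Ω : Type*} [MeasurableSpace Ω] {P : Measure Ω} [IsProbabilityMeasure P]
variable {X : Type*} [MeasurableSpace X] {ν : Measure X} {x : ℕ → Ω → X}

/-- **`√n·U_n(G) → 0` IN PROBABILITY for a degenerate kernel.**  For an independent stream `x_i`
with common law `ν` and a symmetric measurable kernel `G ∈ L²(ν ⊗ ν)` with `∫ G(a, b) dν(b) = 0`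
for every `a`: `Var(√n U_n(G)) = 2∫G²/(n − 1)`, so Chebyshev gives convergence to `0` in
probability. [ours] -/
theorem degenerateUStat_sqrt_tendstoInMeasure_zero (hxm : ∀ i, Measurable (x i))
    (hind : iIndepFun x P) (hlaw : ∀ i, Measure.map (x i) P = ν) {G : X → X → ℝ}
    (hGm : Measurable fun z : X × X => G z.1 z.2) (hG : ∀ a b, G a b = G b a)
    (hG2 : MemLp (fun z : X × X => G z.1 z.2) 2 (ν.prod ν)) (hG0 : ∀ a, ∫ b, G a b ∂ν = 0) :
    TendstoInMeasure P (fun (n : ℕ) ω => Real.sqrt n *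
        ((∑ z ∈ (univ : Finset (Fin n)).offDiag, G (x z.1 ω) (x z.2 ω)) / (n * (n - 1) : ℝ)))
      atTop (fun _ => (0 : ℝ)) := by
  haveI hν : IsProbabilityMeasure ν := by
    rw [← hlaw 0]
    exact Measure.isProbabilityMeasure_map (hxm 0).aemeasurable
  have hmean : ∫ z, G z.1 z.2 ∂(ν.prod ν) = 0 := by
    rw [integral_prod _ (hG2.integrable one_le_two)]
    simp only [hG0, integral_zero]
  have hc1 : ∫ a, (∫ b, G a b ∂ν) ^ 2 ∂ν = 0 := by
    simp only [hG0, zero_pow two_ne_zero, integral_zero]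
  have hc₂0 : 0 ≤ ∫ z, G z.1 z.2 ^ 2 ∂(ν.prod ν) := integral_nonneg fun _ => sq_nonneg _
  rw [tendstoInMeasure_iff_norm]
  intro ε hε
  -- upper bound `4 c₂/(ε² n)` for `n ≥ 2`, which tends to `0`
  have hup : Tendsto (fun n : ℕ => ENNReal.ofReal (4 * (∫ z, G z.1 z.2 ^ 2 ∂(ν.prod ν)) / ε ^ 2
      / n)) atTop (𝓝 0) := by
    rw [← ENNReal.ofReal_zero]
    exact ENNReal.tendsto_ofReal (tendsto_const_div_atTop_nhds_zero_nat _)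
  refine tendsto_of_tendsto_of_tendsto_of_le_of_le' tendsto_const_nhds hup
    (Eventually.of_forall fun n => zero_le) ?_
  filter_upwards [eventually_ge_atTop 2] with n hn
  have h2 : (2 : ℝ) ≤ n := by exact_mod_cast hn
  have hn0 : (0 : ℝ) < n := by linarith
  have hsq : 0 < Real.sqrt n := Real.sqrt_pos.2 hn0
  have hnsq : Real.sqrt n ^ 2 = n := Real.sq_sqrt hn0.le
  have ht : 0 < ε / Real.sqrt n := div_pos hε hsq
  -- Chebyshev at radius `ε/√n`
  have hch := chebyshev_ustat₂_iid (P := P) (ν := ν) (x := fun (i : Fin n) ω => x i ω)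
    (fun i => hxm _) (iIndepFun_prefix hind n) (fun i => hlaw _) (F := G) hGm hG hG2 hn ht
  rw [hmean, hc1] at hch
  simp only [sub_zero, zero_pow two_ne_zero, mul_zero, add_zero] at hch
  -- the events: `ε ≤ ‖√n U − 0‖ ↔ ε/√n ≤ |U|`
  have hsub : {ω | ε ≤ ‖Real.sqrt n *
      ((∑ z ∈ (univ : Finset (Fin n)).offDiag, G (x z.1 ω) (x z.2 ω)) / (n * (n - 1) : ℝ))
        - 0‖}
      ⊆ {ω | ε / Real.sqrt n ≤
        |(∑ z ∈ (univ : Finset (Fin n)).offDiag, G (x z.1 ω) (x z.2 ω)) / (n * (n - 1) : ℝ)|} := by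
    intro ω hω
    simp only [Set.mem_setOf_eq, sub_zero, Real.norm_eq_abs, abs_mul,
      abs_of_pos hsq] at hω ⊢
    rw [div_le_iff₀ hsq, mul_comm]
    exact hω
  refine (measure_mono hsub).trans (hch.trans (ENNReal.ofReal_le_ofReal ?_))
  -- `(2c₂/(n(n−1)))/(ε/√n)² = 2c₂/((n−1)ε²) ≤ 4c₂/(ε² n)`
  have hn1 : (0 : ℝ) < n - 1 := by linarith
  have hkey : (n : ℝ) * (n - 1) * (ε ^ 2 / n) = (n - 1) * ε ^ 2 := by
    field_simp
  simp only [div_pow, hnsq, div_div]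
  rw [hkey, div_le_div_iff₀ (by positivity) (by positivity)]
  nlinarith [mul_nonneg (mul_nonneg hc₂0 (sq_nonneg ε)) (show (0 : ℝ) ≤ 2 * n - 4 by linarith)]

end Degenerate

/-! ## §3 The projection part and the theorem -/

section CLT

variable {Ω : Type*} [MeasurableSpace Ω] {P : Measure Ω} [IsProbabilityMeasure P]
variable {Ω' : Type*} [MeasurableSpace Ω'] {P' : Measure Ω'} [IsProbabilityMeasure P']
variable {X : Type*} [MeasurableSpace X] {ν : Measure X} {x : ℕ → Ω → X} {Y : Ω' → ℝ}

/-- **The projection part**: for an independent stream with common law `ν`, a symmetric measurable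
kernel `F ∈ L²(ν ⊗ ν)` with projection `h` and mean `μ_F`, and `Y ∼ N(0, ζ₁)`,
`ζ₁ = ∫ h² dν − μ_F²`: `2·(Σ_{i<n} h(x_i) − n·μ_F)/√n ⇒ 2·Y`. [ours] (Mathlib's CLT, doubled) -/
theorem tendstoInDistribution_two_mul_projection (hxm : ∀ i, Measurable (x i))
    (hind : iIndepFun x P) (hlaw : ∀ i, Measure.map (x i) P = ν) {F : X → X → ℝ}
    (hFm : Measurable fun z : X × X => F z.1 z.2)
    (hF2 : MemLp (fun z : X × X => F z.1 z.2) 2 (ν.prod ν))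
    (hY : HasLaw Y (gaussianReal 0 ((∫ a, (∫ b, F a b ∂ν) ^ 2 ∂ν)
      - (∫ z, F z.1 z.2 ∂(ν.prod ν)) ^ 2).toNNReal) P') :
    TendstoInDistribution (fun (n : ℕ) ω => 2 * ((Real.sqrt n)⁻¹ *
        (∑ k ∈ range n, (∫ b, F (x k ω) b ∂ν) - n * ∫ z, F z.1 z.2 ∂(ν.prod ν))))
      atTop (fun ω' => 2 * Y ω') (fun _ => P) P' := by
  haveI hν : IsProbabilityMeasure ν := by
    rw [← hlaw 0]
    exact Measure.isProbabilityMeasure_map (hxm 0).aemeasurable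
  have hh2 := memLp_condMean_two hFm hF2
  have hhm : Measurable fun a => ∫ b, F a b ∂ν := (stronglyMeasurable_condMean hFm).measurable
  have hZ2 : MemLp (fun ω => ∫ b, F (x 0 ω) b ∂ν) 2 P := by
    have h : MemLp (fun a => ∫ b, F a b ∂ν) 2 (Measure.map (x 0) P) := by
      rw [hlaw]
      exact hh2
    exact h.comp_of_map (hxm 0).aemeasurable
  have hZind : iIndepFun (fun k ω => ∫ b, F (x k ω) b ∂ν) P :=
    hind.comp (fun _ => fun a => ∫ b, F a b ∂ν) fun _ => hhm
  have hZid : ∀ i, IdentDistrib (fun ω => ∫ b, F (x i ω) b ∂ν) (fun ω => ∫ b, F (x 0 ω) b ∂ν)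
      P P := fun i =>
    ({ aemeasurable_fst := (hxm i).aemeasurable
       aemeasurable_snd := (hxm 0).aemeasurable
       map_eq := by rw [hlaw, hlaw] } : IdentDistrib (x i) (x 0) P P).comp hhm
  have hmean : ∫ ω, (∫ b, F (x 0 ω) b ∂ν) ∂P = ∫ z, F z.1 z.2 ∂(ν.prod ν) := by
    have him := integral_map (μ := P) (hxm 0).aemeasurable (f := fun a => ∫ b, F a b ∂ν)
      (by rw [hlaw]; exact hhm.aestronglyMeasurable)
    rw [hlaw, integral_condMean_eq hF2] at him
    exact him.symm
  have hvar : Var[fun ω => ∫ b, F (x 0 ω) b ∂ν; P]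
      = (∫ a, (∫ b, F a b ∂ν) ^ 2 ∂ν) - (∫ z, F z.1 z.2 ∂(ν.prod ν)) ^ 2 := by
    rw [variance_eq_sub hZ2]
    simp only [Pi.pow_apply]
    have him := integral_map (μ := P) (hxm 0).aemeasurable (f := fun a => (∫ b, F a b ∂ν) ^ 2)
      (by rw [hlaw]; exact (hhm.pow_const 2).aestronglyMeasurable)
    rw [hlaw] at him
    rw [← him, hmean]
  have hY' : HasLaw Y (gaussianReal 0 (Var[fun ω => ∫ b, F (x 0 ω) b ∂ν; P]).toNNReal) P' := by
    rw [hvar]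
    exact hY
  have hclt := tendstoInDistribution_inv_sqrt_mul_sum_sub (P := P) (P' := P')
    (X := fun k ω => ∫ b, F (x k ω) b ∂ν) hY' hZ2 hZind hZid
  rw [hmean] at hclt
  exact hclt.continuous_comp (g := fun t : ℝ => 2 * t) (by fun_prop)

/-- **HOEFFDING'S CENTRAL LIMIT THEOREM FOR AN ORDER-2 U-STATISTIC (square-integrable kernel).**
For an independent stream `x_i` with common law `ν`, a symmetric measurable kernel
`F ∈ L²(ν ⊗ ν)`, and any real random variable `Y` with law `N(0, ζ₁)`,
`ζ₁ = ∫ (∫ F(a, b) dν(b))² dν(a) − (∫ F d(ν ⊗ ν))²` (the variance of Hoeffding's projection):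
`√n·(U_n(F) − ∫ F d(ν ⊗ ν)) ⇒ 2·Y` in distribution (limit law `N(0, 4ζ₁)`). [ours] -/
theorem ustat₂_clt (hxm : ∀ i, Measurable (x i)) (hind : iIndepFun x P)
    (hlaw : ∀ i, Measure.map (x i) P = ν) {F : X → X → ℝ}
    (hFm : Measurable fun z : X × X => F z.1 z.2) (hF : ∀ a b, F a b = F b a)
    (hF2 : MemLp (fun z : X × X => F z.1 z.2) 2 (ν.prod ν))
    (hY : HasLaw Y (gaussianReal 0 ((∫ a, (∫ b, F a b ∂ν) ^ 2 ∂ν)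
      - (∫ z, F z.1 z.2 ∂(ν.prod ν)) ^ 2).toNNReal) P') :
    TendstoInDistribution (fun (n : ℕ) ω => Real.sqrt n *
        ((∑ z ∈ (univ : Finset (Fin n)).offDiag, F (x z.1 ω) (x z.2 ω)) / (n * (n - 1) : ℝ)
          - ∫ z, F z.1 z.2 ∂(ν.prod ν)))
      atTop (fun ω' => 2 * Y ω') (fun _ => P) P' := by
  haveI hν : IsProbabilityMeasure ν := by
    rw [← hlaw 0]
    exact Measure.isProbabilityMeasure_map (hxm 0).aemeasurable
  obtain ⟨m, hm⟩ : ∃ m : ℝ, m = ∫ z, F z.1 z.2 ∂(ν.prod ν) := ⟨_, rfl⟩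
  rw [← hm] at hY ⊢
  have hhm : Measurable fun a => ∫ b, F a b ∂ν := (stronglyMeasurable_condMean hFm).measurable
  -- the projection part
  have hproj := tendstoInDistribution_two_mul_projection (P := P) (P' := P') hxm hind hlaw hFm
    hF2 (Y := Y) (by rw [← hm]; exact hY)
  rw [← hm] at hproj
  -- the degenerate remainder at the `√n` scale
  have hGm := measurable_remainder (ν := ν) hFm
  have hR := degenerateUStat_sqrt_tendstoInMeasure_zero hxm hind hlaw
    (G := fun a b => F a b - (∫ b', F a b' ∂ν) - (∫ b', F b b' ∂ν) + m)
    (by rw [hm]; exact hGm) (by rw [hm]; exact remainder_symm hF)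
    (by rw [hm]; exact memLp_remainder_two hFm hF2)
    (by rw [hm]; exact integral_remainder_section_eq_zero hFm hF2)
  have hRm : ∀ n : ℕ, Measurable fun ω => Real.sqrt n *
      ((∑ z ∈ (univ : Finset (Fin n)).offDiag,
          (F (x z.1 ω) (x z.2 ω) - (∫ b', F (x z.1 ω) b' ∂ν) - (∫ b', F (x z.2 ω) b' ∂ν) + m))
        / (n * (n - 1) : ℝ)) := fun n =>
    ((Finset.measurable_sum _ fun z _ =>
      (((hFm.comp ((hxm z.1).prodMk (hxm z.2))).sub (hhm.comp (hxm z.1))).sub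
        (hhm.comp (hxm z.2))).add_const m).div_const _).const_mul _
  -- Slutsky: projection part plus remainder
  have hsum := hproj.add_of_tendstoInMeasure_const hR (fun n => (hRm n).aemeasurable)
  simp only [add_zero] at hsum
  -- the decomposed sequence agrees with `√n (U_n − m)` for `n ≥ 2`
  have hSm : ∀ n : ℕ, Measurable fun ω => Real.sqrt n *
      ((∑ z ∈ (univ : Finset (Fin n)).offDiag, F (x z.1 ω) (x z.2 ω)) / (n * (n - 1) : ℝ)
        - m) := fun n =>
    ((measurable_ustat₂_iid (x := fun (i : Fin n) ω => x i ω) (fun i => hxm _) hFm).sub_const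
      m).const_mul _
  have hPm : ∀ n : ℕ, Measurable fun ω => 2 * ((Real.sqrt n)⁻¹ *
      (∑ k ∈ range n, (∫ b, F (x k ω) b ∂ν) - n * m)) := fun n =>
    (((Finset.measurable_sum _ fun k _ => hhm.comp (hxm k)).sub_const _).const_mul _).const_mul _
  refine tendstoInDistribution_of_tendstoInMeasure_sub (μ'' := P) (μ' := P') _ _ hsum ?_
    (fun n => (hSm n).aemeasurable)
  refine tendstoInMeasure_of_tendsto_ae
    (fun n => ((hSm n).sub ((hPm n).add (hRm n))).aestronglyMeasurable) ?_
  refine Filter.Eventually.of_forall fun ω => ?_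
  refine (tendsto_const_nhds (x := (0 : ℝ))).congr' ?_
  filter_upwards [eventually_ge_atTop 2] with n hn
  have hn1 : 1 ≤ n := by omega
  rw [Pi.sub_apply, Pi.sub_apply, Pi.add_apply,
    ustat₂_eq_remainder_add hn (fun i j => F (x i ω) (x j ω)) (fun i => ∫ b, F (x i ω) b ∂ν) m,
    Fin.sum_univ_eq_sum_range (fun i => ∫ b, F (x i ω) b ∂ν) n,
    ← sqrt_mul_div_sub hn1 (∑ i ∈ range n, ∫ b, F (x i ω) b ∂ν) m]
  ring

end CLT

end Summit.Ventures.LatticeQCDFlow.Scoring.CardConsistency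

end
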